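import Summits.QuantumFields.BalabanUV.T4Continuum.Support.AveragingDeficitFermat
import HarnessLib

/-!
# T⁴ programme, node NE3 — row E-RES♯, sub-row (R♯2): FINE CRITICALITY OF A CONSTRAINED MINIMISER ALONG EVERY TANGENT
# DIRECTION (not only the face-supported ones), and the CURL-PAIRED residual of the averaged configuration along the push-forward
# of ANY critical fine direction (`residualPairing_torus` fed by it)

NE3 prover lineage P1, gen 20 (cell `pub-balaban`, unit `b2b-balaban-t4-ne3-p1`, row NE3 OWNER; journal RULING «E-RES♯ INTO ROWS»,
2026-08-20).  CONTEXT: row NE3-R2's R0 `AveragingDeficitFermat.fineCritical_of_isLocalMin` proves criticality of a constrained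
minimiser of the fine Wilson action along FACE-SUPPORTED directions only (the packaging `AveragingDeficitDualResidual.FineCritical`
demands `FaceSupported L ψ`), because its consumer `dualResidual_torus` lifts coarse directions by the face lift.  The surviving
variant (R3) of NE3's local half needs a CURL-CONTROLLED lift (the slice lift, `NE3SliceLiftCurl`, NOT face-supported), hence
criticality along GENERAL periodic `𝔲(N)` directions whose push-forward is constraint-tangent.  The Lagrange argument of NE3-R2
(`fermat_of_submersion` on the finite torus chart; surjectivity of the linearised constraint by the periodic face lift) never
uses the support hypothesis; THIS FILE records the general statement:

* §1 **`hasDerivAt_fineAction_vary_of_isLocalMin`** ∕ **`…_of_isMinOn`**: under the hypotheses of NE3-R2's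
  `fineCritical_of_isLocalMin` ∕ `fineCritical_of_isMinOn`, for EVERY skew `L·M`-periodic direction `ψ` with
  `Q′(resDir M (pushDir L V ψ ∘ L•)) = 0`: `HasDerivAt (s ↦ A_fine(V e^{sψ})) 0 0`;
* §2 **`residualPairing_of_isMinOn`**: the β-wall paired with the FINE DRESSED CURL of the lift (NE3-R2's
  `AveragingDeficitResidualPairing.residualPairing_torus`) for such `ψ`:
  `L^{d−4}|D_c| ≤ wallConst·(‖∇_VF‖_{ℓ²}·√(curlSq V ψ) + a²·(dirL1 ψ + curlL1 V ψ))` — the input of (R♯5), where `ψ` will be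
  the dressed slice lift of a coarse tangent direction ((R♯3)+(R♯4), not here).

HONEST FRAMING.  A re-packaging of NE3-R2's kernel theorems (same proof, support hypothesis dropped); nothing printed is a
hypothesis (context: [Balaban1985Variational] (75)–(77) p.289, (82)–(84) p.290, §E (115)–(121) p.295); (RES♯), T-E_w♯, NE3 NOT
proved; spine PROVED 0∕9; finite T⁴ rung (B)+1 — NOT infinite volume, NOT mass gap, NOT `BetaPertH`, NOT Clay.  No `def`, no
`sorry`.  PLACEMENT: `Summits/QuantumFields/BalabanUV/`.  HONEST DEPENDENCY (cell page 1): continuum YM on T⁴ ⇐ BetaPertH ∧ nine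
spine estimates (0/9 proved); BetaPertH ⇐ (D1) ∧ (D4) ∧ CAP+tail; G-an2-4 gates asym, D1 and NE2/3/4.
-/

set_option autoImplicit false

open scoped BigOperators Matrix Matrix.Norms.L2Operator Topology
open NormedSpace Finset Filter

namespace Summit.QuantumFields.BalabanUV.T4Continuum.NE3FineCriticalGeneral

open Literature.MathematicalPhysics.QuantumFieldTheory.Balaban1983to89
open B7Prop1Explicit B7Prop2Explicit MatrixLog UnitaryModel
open T4AveragingDeficitWall hiding Site Plane Plaq Bond
open T4AveragingDeficitWallBoundary (IsPeriodicCfg periodBox)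
open AveragingDeficitTransport AveragingDeficitPlaqDeriv AveragingDeficitSideDeriv AveragingDeficitPeriodicCounting
open AveragingDeficitDerivWallProof AveragingDeficitResidualPairing AveragingDeficitFaceWords AveragingDeficitFaceLift
open AveragingDeficitLiftPeriodic
open AveragingDeficitDualResidual AveragingDeficitTorusChart AveragingDeficitChartCalculus
open AveragingDeficitFermat

noncomputable section

variable {d : ℕ} {n : Type*} [Fintype n] [DecidableEq n]

/-! ## §1 Fine criticality along every tangent direction -/

/-- **FINE CRITICALITY OF A CONSTRAINED LOCAL MINIMISER ALONG EVERY TANGENT DIRECTION.**  Same hypotheses as NE3-R2's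
`AveragingDeficitFermat.fineCritical_of_isLocalMin` (`V` unitary of period `L·M`, `SmallField V a`, `liftSmall d L·a ≤ 1`; a
constraint `Q` through the average, strictly differentiable in the coarse chart at `cavg L V` with differential `Q′` onto from
the `𝔲(N)` directions; `V` a local minimiser of the fine Wilson action of the period on `{Q(cavg L U) = Q(cavg L V)} ∩ Near`):
THEN for EVERY skew `L·M`-periodic fine direction `ψ` whose push-forward is constraint-tangent, `Q′(resDir M (pushDir L V ψ ∘ L•)) = 0`,
the fine action is critical along `ψ`: `HasDerivAt (s ↦ A_fine(V e^{sψ})) 0 0`.  (NE3-R2's proof, verbatim, with the unused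
support hypothesis dropped.) [folklore] -/
theorem hasDerivAt_fineAction_vary_of_isLocalMin [Nonempty n] {L M : ℕ} [NeZero L] [NeZero M] {V : Site d → Fin d → (Matrix n n ℂ)ˣ}
    (hV : IsUnitaryCfg V) (hVP : IsPeriodicCfg V ((L : ℤ) * M)) {a : ℝ} (ha : 0 ≤ a)
    (hsmall : liftSmall d L * a ≤ 1) (hVa : SmallField V a)
    {G : Type*} [NormedAddCommGroup G] [NormedSpace ℝ G] [CompleteSpace G]
    (Q : (Site d → Fin d → (Matrix n n ℂ)ˣ) → G) (Q' : TDir d n M →L[ℝ] G)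
    (hQ : HasStrictFDerivAt (fun Φ : TDir d n M => Q (chart (ContinuousLinearMap.id ℝ (Matrix n n ℂ)) M (cavg L V) Φ)) Q' 0)
    (hQ' : ∀ γ : G, ∃ Φ : TDir d n M, (∀ r κ, Φ r κ ∈ skewAdjoint (Matrix n n ℂ)) ∧ Q' Φ = γ)
    (Near : (Site d → Fin d → (Matrix n n ℂ)ˣ) → Prop) (hNear : ∀ᶠ θ in 𝓝 (0 : TDir d n (L * M)), Near (chart skewP (L * M) V θ))
    (hmin : ∀ U : Site d → Fin d → (Matrix n n ℂ)ˣ, IsUnitaryCfg U → IsPeriodicCfg U ((L : ℤ) * M) → Near U →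
      Q (cavg L U) = Q (cavg L V) →
        fineAction V (blockWindow L (periodBox M)).2 ≤ fineAction U (blockWindow L (periodBox M)).2)
    {ψ : Site d → Fin d → Matrix n n ℂ} (hψs : IsSkewDir ψ) (hψP : IsPeriodicDir ψ ((L : ℤ) * M))
    (hTc : Q' (resDir M (fun y κ => pushDir L V ψ ((L : ℤ) • y) κ)) = 0) :
    HasDerivAt (fun s : ℝ => fineAction (vary V ψ s) (blockWindow L (periodBox M)).2) 0 0 := by
  have hL : 1 ≤ L := Nat.one_le_iff_ne_zero.mpr (NeZero.ne L)
  have h512 : 512 * (d + 1) * (d + 4) * (L : ℝ) ^ 2 * a ≤ 1 := small512_of_liftSmall hL ha hsmall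
  have hW : ∀ (q : Site d) (κ : Fin d) (r : Fin d → Fin L), ‖((Wcx L V q κ (boxVec L r) : (Matrix n n ℂ)ˣ) : Matrix n n ℂ) - 1‖ < 1 :=
    norm_Wcx_sub_one_lt_one_of_smallField L hL hV ha h512 hVa
  have hVP' : IsPeriodicCfg V ((L * M : ℕ) : ℤ) := by rw [natCast_mul_period]; exact hVP
  set Wf := (blockWindow L (periodBox (d := d) M)).2 with hWf
  -- the chart action and the chart constraint
  set A : TDir d n (L * M) → ℝ := fun θ => fineAction (chart skewP (L * M) V θ) Wf with hA
  set F : TDir d n (L * M) → G := fun θ => Q (cavg L (chart skewP (L * M) V θ)) with hF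
  -- strict differentiability of the action
  have hAd : HasStrictFDerivAt A (fderiv ℝ A 0) 0 :=
    (contDiffAt_fineAction_chart (m := 1) skewP (L * M) V Wf 0).hasStrictFDerivAt one_ne_zero
  -- strict differentiability of the constraint: `F = Q ∘ chart_id ∘ coord` near `0`
  have hcoord : HasStrictFDerivAt (coord skewP L M V) (fderiv ℝ (coord skewP L M V) 0) 0 :=
    (contDiffAt_coord (m := 1) skewP L M V hW).hasStrictFDerivAt one_ne_zero
  have hQ0 : HasStrictFDerivAt (fun Φ : TDir d n M => Q (chart (ContinuousLinearMap.id ℝ (Matrix n n ℂ)) M (cavg L V) Φ)) Q'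
      (coord skewP L M V 0) := by
    rw [coord_zero]; exact hQ
  have hFd : HasStrictFDerivAt F (Q'.comp (fderiv ℝ (coord skewP L M V) 0)) 0 := by
    refine (hQ0.comp 0 hcoord).congr_of_eventuallyEq ?_
    exact (eventually_cavg_chart_eq hL hV hVP ha h512 hVa).mono fun θ hθ => by
      simp only [hF, hθ]
  -- the differential of the constraint is onto (the periodic face lift)
  have hsurj : Function.Surjective (Q'.comp (fderiv ℝ (coord skewP L M V) 0)) := by
    intro γ
    obtain ⟨Φ, hΦs, hΦ⟩ := hQ' γ
    have hφP : ∀ (y : Site d) (j κ : Fin d), extDir M Φ (y + (M : ℤ) • e j) κ = extDir M Φ y κ :=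
      fun y j κ => isPeriodicDir_extDir M Φ y j κ
    obtain ⟨χ, hχF, hχP, hχpush, -, hχs⟩ := exists_lift_periodic hL hV hVP ha hsmall hVa (extDir M Φ) hφP
    have hχskew : IsSkewDir χ := hχs fun y κ => hΦs _ _
    have hχP' : IsPeriodicDir χ ((L * M : ℕ) : ℤ) := by rw [natCast_mul_period]; exact hχP
    refine ⟨resDir (L * M) χ, ?_⟩
    rw [ContinuousLinearMap.comp_apply, ← hΦ]
    congr 1
    funext r κ
    rw [fderiv_coord_apply skewP L M V hW, chartDir_skewP_resDir (L * M) hχP' hχskew, hχpush]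
    simp only [extDir, redN_boxVec]
  -- the minimiser is a local minimiser in the chart
  have hloc : IsLocalMinOn A {θ | F θ = F 0} 0 := by
    refine eventually_nhdsWithin_iff.mpr (hNear.mono fun θ hθ hθF => ?_)
    simp only [Set.mem_setOf_eq, hF, chart_zero] at hθF
    simp only [hA, chart_zero]
    have hθP : IsPeriodicCfg (chart skewP (L * M) V θ) ((L : ℤ) * M) := by
      have h := isPeriodicCfg_chart skewP (L * M) hVP' θ
      rw [natCast_mul_period] at h
      exact h
    exact hmin _ (isUnitaryCfg_chart (L * M) hV θ) hθP hθ hθF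
  -- Fermat along the restriction of `ψ`
  have hψP' : IsPeriodicDir ψ ((L * M : ℕ) : ℤ) := by rw [natCast_mul_period]; exact hψP
  have hker : (Q'.comp (fderiv ℝ (coord skewP L M V) 0)) (resDir (L * M) ψ) = 0 := by
    rw [ContinuousLinearMap.comp_apply]
    have e : (fderiv ℝ (coord skewP L M V) 0) (resDir (L * M) ψ)
        = resDir M (fun y κ => pushDir L V ψ ((L : ℤ) • y) κ) := by
      funext r κ
      rw [fderiv_coord_apply skewP L M V hW, chartDir_skewP_resDir (L * M) hψP' hψs]
      rfl
    rw [e]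
    exact hTc
  have hzero := fermat_of_submersion hloc hFd hAd hsurj hker
  have hder := hasDerivAt_fineAction_chartDir skewP (L * M) V Wf (resDir (L * M) ψ)
  rw [chartDir_skewP_resDir (L * M) hψP' hψs] at hder
  rw [show fderiv ℝ (fun ψ' : TDir d n (L * M) => fineAction (chart skewP (L * M) V ψ') Wf) 0 = fderiv ℝ A 0 from rfl,
    hzero] at hder
  exact hder

/-- **The small-field version** (NE3-R2's `fineCritical_of_isMinOn` with the support hypothesis dropped): `Near U := SmallField U b`
for some `b > a` (`eventually_smallField_chart`).  If `V` minimises the fine action of the period among the unitary `L·M`-periodic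
`U` with `SmallField U b` obeying `Q(cavg L U) = Q(cavg L V)`, then the fine action is critical along EVERY skew `L·M`-periodic
`ψ` with `Q′(resDir M (pushDir L V ψ ∘ L•)) = 0`. [folklore] -/
theorem hasDerivAt_fineAction_vary_of_isMinOn [Nonempty n] {L M : ℕ} [NeZero L] [NeZero M] {V : Site d → Fin d → (Matrix n n ℂ)ˣ}
    (hV : IsUnitaryCfg V) (hVP : IsPeriodicCfg V ((L : ℤ) * M)) {a b : ℝ} (ha : 0 ≤ a) (hab : a < b)
    (hsmall : liftSmall d L * a ≤ 1) (hVa : SmallField V a)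
    {G : Type*} [NormedAddCommGroup G] [NormedSpace ℝ G] [CompleteSpace G]
    (Q : (Site d → Fin d → (Matrix n n ℂ)ˣ) → G) (Q' : TDir d n M →L[ℝ] G)
    (hQ : HasStrictFDerivAt (fun Φ : TDir d n M => Q (chart (ContinuousLinearMap.id ℝ (Matrix n n ℂ)) M (cavg L V) Φ)) Q' 0)
    (hQ' : ∀ γ : G, ∃ Φ : TDir d n M, (∀ r κ, Φ r κ ∈ skewAdjoint (Matrix n n ℂ)) ∧ Q' Φ = γ)
    (hmin : ∀ U : Site d → Fin d → (Matrix n n ℂ)ˣ, IsUnitaryCfg U → IsPeriodicCfg U ((L : ℤ) * M) → SmallField U b →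
      Q (cavg L U) = Q (cavg L V) →
        fineAction V (blockWindow L (periodBox M)).2 ≤ fineAction U (blockWindow L (periodBox M)).2)
    {ψ : Site d → Fin d → Matrix n n ℂ} (hψs : IsSkewDir ψ) (hψP : IsPeriodicDir ψ ((L : ℤ) * M))
    (hTc : Q' (resDir M (fun y κ => pushDir L V ψ ((L : ℤ) • y) κ)) = 0) :
    HasDerivAt (fun s : ℝ => fineAction (vary V ψ s) (blockWindow L (periodBox M)).2) 0 0 := by
  have hVP' : IsPeriodicCfg V ((L * M : ℕ) : ℤ) := by rw [natCast_mul_period]; exact hVP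
  exact hasDerivAt_fineAction_vary_of_isLocalMin hV hVP ha hsmall hVa Q Q' hQ hQ' (fun U => SmallField U b)
    (eventually_smallField_chart skewP (L * M) hVP' hab hVa) hmin hψs hψP hTc

/-! ## §2 The curl-paired residual along the push-forward of a critical fine direction -/

/-- **THE β-WALL PAIRED WITH THE FINE DRESSED CURL OF THE LIFT, FOR A CONSTRAINED MINIMISER AND ANY TANGENT FINE DIRECTION.**
Under the hypotheses of `hasDerivAt_fineAction_vary_of_isMinOn`, for every skew `L·M`-periodic `ψ` with constraint-tangent
push-forward and every derivative `D_c` at `0` of the coarse action along the push-forward, `s ↦ A^L_{[0,M)^d}(V̄ e^{s·pushDir ψ})`: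
`L^{d−4}·|D_c| ≤ wallConst·(‖∇_VF‖_{ℓ²(period)}·√(curlSq V ψ (period)) + a²·(dirL1 ψ + curlL1 V ψ)(period))` — NE3-R2's
`residualPairing_torus` with its criticality hypothesis discharged by §1.  With a CURL-CONTROLLED lift `ψ` of a coarse tangent
direction `φ` ((R♯3)+(R♯4)) this is (RES♯) `CurlPairedResidual`; with the face lift it is NE3-R2's `dualResidual_minimiser`. [folklore] -/
theorem residualPairing_of_isMinOn [Nonempty n] {L M : ℕ} [NeZero L] [NeZero M] {V : Site d → Fin d → (Matrix n n ℂ)ˣ}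
    (hV : IsUnitaryCfg V) (hVP : IsPeriodicCfg V ((L : ℤ) * M)) {a b : ℝ} (ha : 0 ≤ a) (hab : a < b)
    (hsmall : liftSmall d L * a ≤ 1) (hVa : SmallField V a)
    {G : Type*} [NormedAddCommGroup G] [NormedSpace ℝ G] [CompleteSpace G]
    (Q : (Site d → Fin d → (Matrix n n ℂ)ˣ) → G) (Q' : TDir d n M →L[ℝ] G)
    (hQ : HasStrictFDerivAt (fun Φ : TDir d n M => Q (chart (ContinuousLinearMap.id ℝ (Matrix n n ℂ)) M (cavg L V) Φ)) Q' 0)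
    (hQ' : ∀ γ : G, ∃ Φ : TDir d n M, (∀ r κ, Φ r κ ∈ skewAdjoint (Matrix n n ℂ)) ∧ Q' Φ = γ)
    (hmin : ∀ U : Site d → Fin d → (Matrix n n ℂ)ˣ, IsUnitaryCfg U → IsPeriodicCfg U ((L : ℤ) * M) → SmallField U b →
      Q (cavg L U) = Q (cavg L V) →
        fineAction V (blockWindow L (periodBox M)).2 ≤ fineAction U (blockWindow L (periodBox M)).2)
    {ψ : Site d → Fin d → Matrix n n ℂ} (hψs : IsSkewDir ψ) (hψP : IsPeriodicDir ψ ((L : ℤ) * M))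
    (hTc : Q' (resDir M (fun y κ => pushDir L V ψ ((L : ℤ) • y) κ)) = 0) {Dc : ℝ}
    (hDc : HasDerivAt
      (fun s : ℝ => coarseActionOf L (vary (bavg L V) (pushDir L V ψ) s) (blockWindow L (periodBox M)).1) Dc 0) :
    (L : ℝ) ^ ((d : ℤ) - 4) * |Dc|
      ≤ wallConst d L * (Real.sqrt (gradFluxSq V (blockSites L (periodBox M)))
          * Real.sqrt (curlSq V ψ (blockSites L (periodBox M)))
        + a ^ 2 * (dirL1 ψ (blockSites L (periodBox M)) + curlL1 V ψ (blockSites L (periodBox M)))) := by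
  have hL : 1 ≤ L := Nat.one_le_iff_ne_zero.mpr (NeZero.ne L)
  have hM : 1 ≤ M := Nat.one_le_iff_ne_zero.mpr (NeZero.ne M)
  have hcrit := hasDerivAt_fineAction_vary_of_isMinOn hV hVP ha hab hsmall hVa Q Q' hQ hQ' hmin hψs hψP hTc
  -- the B7 smallness from `liftSmall`
  have ha₀ : a ≤ 1 / (512 * (d + 1) * (d + 4) * (L : ℝ) ^ 2) := by
    have h512 : 512 * (d + 1) * (d + 4) * (L : ℝ) ^ 2 * a ≤ 1 := small512_of_liftSmall hL ha hsmall
    have hK : (0 : ℝ) < 512 * (d + 1) * (d + 4) * (L : ℝ) ^ 2 := by positivity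
    rw [le_div_iff₀ hK]
    linarith
  exact residualPairing_torus L hL hM hV hVP ha ha₀ hVa hψs hψP hcrit hDc

end

end Summit.QuantumFields.BalabanUV.T4Continuum.NE3FineCriticalGeneral
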